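import Summits.Ventures.PercRepro.CogirthRLS
import Summits.Ventures.PercRepro.C025Profile

/-!
# PercRepro — the profile inequality `Π_{q,u}` on every matroid of cogirth `≥ q + 1` (p9, gen 16)

A feeder result for S5 (night-3's / p10's profile inequality `Profile.ProfileIneq M q u`: `Σ_{B : ρ(B) = q}
price(B) ≤ #{S : ρ(S) = u}`, with the price `C(ρ(E∖B)+q, u)/C(ρ(E∖B)+q, q)` when `ρ(E ∖ B) ≥ u`, else `0`). On a
matroid of rank `r` the price is at most `C(r+q, u)/C(r+q, q)` (`price_le`: the ratio `C(n, u)/C(n, q)` is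
increasing in `n` for `q ≤ u`, `choose_mul_choose_le`), so `Π_{q,u}` follows from `c_q·C(r+q, u) ≤ c_u·C(r+q, q)`
— the rank-distribution inequality of `CogirthRLS.levelCount_mul_choose` at `p := r`, available under rank
deficiency at `(r, q)`, hence (`rankDeficient_of_hyperplanes`) whenever every cocircuit has `≥ q + 1` elements:
**`profileIneq_of_cogirth`: cogirth `≥ q + 1` ⟹ `Π_{q,u}` for every `q < u ≤ ρ(E)`** — a regime of Π beside the
rows `q ≤ 2`, girth `≥ u + 1` and `u = ρ(E)`. The bridge `card_levelSet_eq_levelCount` identifies night-2's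
`Shadow.levelSet M u` (rank-`u` finsets) with the rank distribution `levelCount M u` (rank-`u` sets).
Nothing about any window.
-/

namespace PercRepro.RankDist

open Set Finset Matroid PercRepro.ThmH

variable {α : Type}

/-- `C(n, u)/C(n, q)` is nondecreasing in `n` for `q ≤ u`: `C(n, u)·C(n', q) ≤ C(n', u)·C(n, q)` for `n ≤ n'`. -/
theorem choose_mul_choose_le (q u n n' : ℕ) (hqu : q ≤ u) (hnn : n ≤ n') :
    n.choose u * n'.choose q ≤ n'.choose u * n.choose q := by
  have h1 := Nat.choose_mul (n := n) (k := u) (s := q) hqu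
  have h2 := Nat.choose_mul (n := n') (k := u) (s := q) hqu
  have h3 : (n - q).choose (u - q) ≤ (n' - q).choose (u - q) :=
    Nat.choose_le_choose _ (Nat.sub_le_sub_right hnn q)
  have hpos : 0 < u.choose q := Nat.choose_pos hqu
  refine Nat.le_of_mul_le_mul_right ?_ hpos
  calc n.choose u * n'.choose q * u.choose q = (n.choose u * u.choose q) * n'.choose q := by ring
    _ = (n.choose q * (n - q).choose (u - q)) * n'.choose q := by rw [h1]
    _ ≤ (n.choose q * (n' - q).choose (u - q)) * n'.choose q := by
        exact Nat.mul_le_mul_right _ (Nat.mul_le_mul_left _ h3)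
    _ = (n'.choose u * u.choose q) * n.choose q := by rw [h2]; ring
    _ = n'.choose u * n.choose q * u.choose q := by ring

variable [DecidableEq α] (M : Matroid α) [M.Finite]

omit [DecidableEq α] in
/-- The rank-`u` finsets of `Shadow.levelSet` are in bijection with the rank-`u` sets of `levelCount`. -/
theorem card_levelSet_eq_levelCount (u : ℕ) : (Shadow.levelSet M u).card = levelCount M u := by
  classical
  apply le_antisymm
  · rw [levelCount]
    refine Finset.card_le_card_of_injOn (fun S => (S : Set α)) ?_ ?_
    · intro S hS
      rw [Finset.mem_coe, Profile.mem_levelSet] at hS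
      rw [Finset.mem_coe, mem_filter, mem_subsetsFin]
      have hSE : (S : Set α) ⊆ M.E := by rw [← coe_gr M]; exact Finset.coe_subset.2 hS.1
      exact ⟨hSE, (rk_eq_iff M hSE u).2 hS.2⟩
    · intro S _ T _ hST
      exact Finset.coe_injective hST
  · rw [levelCount]
    refine Finset.card_le_card_of_injOn (fun A => (gr M).filter (fun e => e ∈ A)) ?_ ?_
    · intro A hA
      rw [Finset.mem_coe, mem_filter, mem_subsetsFin] at hA
      have hcoe : (((gr M).filter (fun e => e ∈ A) : Finset α) : Set α) = A := by
        ext e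
        simp only [Finset.coe_filter, mem_setOf_eq]
        exact ⟨fun h => h.2, fun h => ⟨by rw [← Finset.mem_coe, coe_gr]; exact hA.1 h, h⟩⟩
      rw [Finset.mem_coe, Profile.mem_levelSet, hcoe]
      exact ⟨Finset.filter_subset _ _, (rk_eq_iff M hA.1 u).1 hA.2⟩
    · intro A hA B hB hAB
      rw [Finset.mem_coe, mem_filter, mem_subsetsFin] at hA hB
      have hcoe : ∀ C : Set α, C ⊆ M.E → (((gr M).filter (fun e => e ∈ C) : Finset α) : Set α) = C := by
        intro C hC
        ext e
        simp only [Finset.coe_filter, mem_setOf_eq]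
        exact ⟨fun h => h.2, fun h => ⟨by rw [← Finset.mem_coe, coe_gr]; exact hC h, h⟩⟩
      rw [← hcoe A hA.1, ← hcoe B hB.1]
      simp only at hAB
      rw [hAB]

omit [DecidableEq α] in
/-- `Rq` is the level set of rank `q`. -/
theorem card_Rq_eq_levelCount (q : ℕ) : (Profile.Rq M q).card = levelCount M q :=
  card_levelSet_eq_levelCount M q

/-- On a matroid of rank `r`, every price at `(q, u)` with `q ≤ u` is at most `C(r+q, u)/C(r+q, q)`. -/
theorem price_le (q u r : ℕ) (hr : M.eRank = (r : ℕ∞)) (hqu : q ≤ u) (B : Finset α) :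
    Profile.price M q u B ≤ ((r + q).choose u : ℚ) / ((r + q).choose q : ℚ) := by
  unfold Profile.price
  split_ifs with h
  · set p' := (M.eRk ((gr M \ B : Finset α) : Set α)).toNat with hp'
    have hp'r : p' ≤ r := by
      have h1 := M.eRk_le_eRank ((gr M \ B : Finset α) : Set α)
      rw [hr] at h1
      have h2 := ENat.toNat_le_toNat h1 (by simp)
      simpa [hp'] using h2
    have hd1 : (0 : ℚ) < ((p' + q).choose q : ℚ) := by exact_mod_cast Nat.choose_pos (by omega)
    have hd2 : (0 : ℚ) < ((r + q).choose q : ℚ) := by exact_mod_cast Nat.choose_pos (by omega)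
    rw [div_le_div_iff₀ hd1 hd2]
    exact_mod_cast choose_mul_choose_le q u (p' + q) (r + q) hqu (by omega)
  · exact div_nonneg (Nat.cast_nonneg _) (Nat.cast_nonneg _)

/-- **`Π_{q,u}` UNDER RANK DEFICIENCY**: on a matroid of rank `r`, rank deficiency at `(r, q)` gives the profile
inequality at `(q, u)` for every `q ≤ u ≤ r`. -/
theorem profileIneq_of_rankDeficient (q u r : ℕ) (hr : M.eRank = (r : ℕ∞)) (hqu : q ≤ u) (hur : u ≤ r)
    (hdef : RankDeficient M r q) : Profile.ProfileIneq M q u := by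
  unfold Profile.ProfileIneq
  rw [card_levelSet_eq_levelCount]
  have hsum : ∑ B ∈ Profile.Rq M q, Profile.price M q u B
      ≤ ((Profile.Rq M q).card : ℚ) * (((r + q).choose u : ℚ) / ((r + q).choose q : ℚ)) := by
    have := Finset.sum_le_card_nsmul (Profile.Rq M q) (fun B => Profile.price M q u B)
      (((r + q).choose u : ℚ) / ((r + q).choose q : ℚ)) (fun B _ => price_le M q u r hr hqu B)
    simpa [nsmul_eq_mul] using this
  refine hsum.trans ?_
  rw [card_Rq_eq_levelCount]
  have hd : (0 : ℚ) < ((r + q).choose q : ℚ) := by exact_mod_cast Nat.choose_pos (by omega)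
  rw [← mul_div_assoc, div_le_iff₀ hd]
  exact_mod_cast levelCount_mul_choose M r q hdef u hqu hur

/-- **THE PROFILE INEQUALITY ON EVERY MATROID OF COGIRTH `≥ q + 1`**: if every set of rank `ρ(E) − 1` misses at
least `q + 1` elements of `E` in its closure (every cocircuit has `≥ q + 1` elements), then `Π_{q,u}` holds for every
`q ≤ u ≤ ρ(E)`. -/
theorem profileIneq_of_cogirth (q u r : ℕ) (hr : M.eRank = (r : ℕ∞)) (hqu : q ≤ u) (hur : u ≤ r)
    (hhyp : ∀ A ⊆ M.E, M.eRk A + 1 = (r : ℕ∞) → q + 1 ≤ (M.E \ M.closure A).ncard) :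
    Profile.ProfileIneq M q u :=
  profileIneq_of_rankDeficient M q u r hr hqu hur (rankDeficient_of_hyperplanes M r q r hr le_rfl hhyp)

end PercRepro.RankDist
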